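import Mathlib
import Summits.NavierStokesRegularity.NavierStokesRegularity.Theorems.TaoLadderRungTwoFlatScheduleLink
import HarnessLib

/-!
# SCHEDULE ROW SOUNDNESS for the interface loop of record — the dictionary lemma
  `Row.OK ⟹ scalar hypotheses of HopTube.tubeStepNearBehindR54_of_schedule_iface` (theory-1 g48 asks P-61c/62.x; helper for
  the K_A♭ parent item stmt-NavierStokesRegularity-22987 `FlatGapCertificatesV2`, child 2A `GradedAdiabaticWakeA` of route
  TaoLadderRungTwoFlat; cell harvest/h2-tao-ladder, p1 g24; LADDER §61)

`Schedule59.scheduleRow_sound` (p1 g23) is the dictionary for the composition of record with the core input `r_c` EXOGENOUS.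
The interface-loop composition `HopTube.tubeStepNearBehindR54_of_schedule_iface` (p1 g24, P-61a) has the same ten scalar
hypotheses with two changes — the core input is the certified interface bound `rI` (`RBAR, BBAR ≤ rI`, so `A₀ = M + rI`,
`rI ≤ A`), and the top summand of the near edge input is the LEVEL-fed (D16) form `1·rI·(2·V̄N + ε·rI·√(2·V̄N) + (1+ε)·M·rI)` —
and three more: the pump/carrier level `hlevC` (L-61a), the bond level `hlevV` (L-61b), with the certificate's rational weights
`I1H`, `I2H` AS the analytic weights (link facts `2(e^{θ_V/2} − 1) ≤ I1H·θ_V`, `e^{θ_V} − 1 ≤ I2H·θ_V` are supplied to the step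
theorem directly, e.g. at `θ_V = 1` from `Real.exp_one_lt_d9`). This module proves ONCE, over arbitrary reals, that a certificate
row (theory-1 numT61/62 `Row.OK` conjuncts: the numT59L ones with `r ↦ R01`, the D16 `hlevN`, `hpump`, `hlevC`, `hlevV` with inner
levels `RBARA ≥ RBAR`, `BBARA ≥ BBAR`) together with the link facts of `…ScheduleLink` implies those hypotheses in their literal
shapes. Pure monotonicity bookkeeping, patterned on `Schedule59.scheduleRow_sound`.

* `scheduleRowIface_sound`.

HONEST FRAMING: real-arithmetic bookkeeping for MODEL-lattice schedule certificates; nothing certified about any lattice here;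
no item closed; nothing about the Navier–Stokes equations.
-/

noncomputable section

-- the sub-problem namespace repeats the summit name by design (D-0017)
set_option linter.dupNamespace false

namespace Summit.NavierStokesRegularity.NavierStokesRegularity.Theorems.Schedule61

open Set Schedule59.Link

set_option maxHeartbeats 400000 in
/-- **ROW SOUNDNESS, interface loop.** See the module docstring. [cite: Tao2016AveragedNS, §6.3–6.4 (statement shape of the inductive step's constants); cell LADDER §61 (numT61 dictionary P-61c, theory-1 g48)] -/
theorem scheduleRowIface_sound
    -- global data of the certificate
    {θV θ' M rk RT EW c0 tlo EPSC Dr Kr : ℝ}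
    (hM0 : 0 ≤ M) (hrk0 : 0 ≤ rk) (htlo0 : 0 ≤ tlo) (htc : tlo ≤ c0)
    (hEPSC : 0 ≤ EPSC) (hθV : 0 ≤ θV) (hθ : 0 ≤ θ') (hDK : 0 ≤ Dr - Kr)
    -- enclosure constants and their analytic meaning (link facts)
    {EHH SHH EHI DISC EHB SHB THPLO IOTA SDH SEWH SRTH FEEDH : ℝ}
    (hEHH : Real.exp (θV / 2) ≤ EHH) (hSHH : Real.sinh (θV / 2) ≤ SHH) (hEHI : Real.exp θV ≤ EHI)
    (hDISC : Real.exp (θV * ((1 : ℝ) - Dr + Kr)) ≤ DISC)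
    (hEHB : Real.exp (θ' / 2) ≤ EHB) (hSHB : Real.sinh (θ' / 2) ≤ SHB) (hTHPLO : THPLO ≤ θ')
    (hIOTA : 1 / Real.sqrt (1 - Real.exp (-θ')) ≤ IOTA)
    (hSDH : Real.sqrt Dr ≤ SDH) (hSEWH : Real.sqrt EW ≤ SEWH) (hSRTH : Real.sqrt RT ≤ SRTH)
    (hFEEDH : Real.exp (θ' / 2) * Real.exp (θ' * (Dr - Kr) / 2) ≤ FEEDH)
    -- the row
    {v W r aKdev Q SN SWb VbarN VbarB S2BH S2BL S2NH Aeff muN muB SIN vn Wn Qf : ℝ}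
    (hSN : 0 ≤ SN ∧ v + aKdev ^ 2 ≤ SN ^ 2) (hSWb : 0 ≤ SWb ∧ W + (M + aKdev) ^ 2 ≤ SWb ^ 2)
    (hS2BH : 0 ≤ S2BH ∧ 2 * VbarB ≤ S2BH ^ 2) (hS2BL : 0 ≤ S2BL ∧ S2BL ^ 2 ≤ 2 * VbarB)
    (hS2NH : 0 ≤ S2NH ∧ 2 * VbarN ≤ S2NH ^ 2) (hVNrow : 0 ≤ VbarN)
    (hAeffrow : 2 * VbarB * EHB ^ 2 ≤ Aeff ^ 2 ∧ 0 ≤ Aeff ∧ M + r ≤ Aeff) (hrrow : r ≤ M + S2BL)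
    (hμNrow : 0 < muN ∧ muN ≤ 1 / c0 * θV - 2 * (1 + EPSC) * ((S2BH * FEEDH + M) * SHH + M * (3 + EHI)))
    (hμBrow : 0 < muB ∧ muB ≤ THPLO / c0 - 2 * (1 + EPSC) * Aeff * SHB)
    (hlevNrow : (SN + SDH * rk + SEWH) ^ 2 + (DISC * ((1 + EPSC) * 1 * (S2BH * FEEDH + M) ^ 2 * ((S2BH * FEEDH + M) + M))
        + 1 * r * (2 * VbarN + EPSC * r * S2NH + (1 + EPSC) * M * r)) * c0 < VbarN)
    (hlevBrow : (SWb + rk * IOTA) ^ 2 + (M + S2NH * EHH) * (M + r) * ((M + S2NH * EHH) + EPSC * (M + r)) * c0 < VbarB)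
    (hSIN : 0 ≤ SIN ∧ (SN + SDH * rk + SEWH) ^ 2 * (1 / (1 + muN * tlo + (muN * tlo) ^ 2 / 2))
        + (DISC * ((1 + EPSC) * 1 * (S2BH * FEEDH + M) ^ 2 * ((S2BH * FEEDH + M) + M))
          + 1 * r * (2 * VbarN + EPSC * r * S2NH + (1 + EPSC) * M * r)) * c0 ≤ SIN ^ 2)
    (hbudNrow : (SIN + SRTH) ^ 2 ≤ Q * vn)
    (hbudBrow : (SWb + rk * IOTA) ^ 2 * (1 / (1 + muB * tlo + (muB * tlo) ^ 2 / 2))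
        + (M + S2NH * EHH) * (M + r) * ((M + S2NH * EHH) + EPSC * (M + r)) * c0 ≤ Q * Wn)
    (hsigns : 0 ≤ v ∧ 0 ≤ W ∧ 0 ≤ r ∧ 0 ≤ aKdev ∧ 0 < Q ∧ 0 ≤ vn ∧ 0 ≤ Wn) (hQf : Q ≤ Qf)
    -- the interface rows (numT61): inner levels `RA ≥ RBAR`, `BA ≥ BBAR`, pump, carrier/bond levels
    {RBAR BBAR RA BA rs PUMProw M2 RHO2 I1H I2H : ℝ}
    (hRB0 : 0 ≤ RBAR) (hBB0 : 0 ≤ BBAR) (hR01 : RBAR ≤ r ∧ BBAR ≤ r) (hRA : RBAR ≤ RA) (hBA : BBAR ≤ BA)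
    (hM2 : 0 ≤ M2) (hRHO2 : 0 ≤ RHO2) (hI1H : 0 ≤ I1H)
    (hpumprow : 1 * c0 * ((2 + EPSC) * M * I1H * S2NH + 2 * I2H * VbarN) ≤ PUMProw)
    (hlevCrow : rs + PUMProw + 1 * c0 * ((EPSC * (M + I1H * S2NH) + EPSC * M + EPSC * BA) * RA
      + (2 + EPSC) * M * BA + BA ^ 2) < RBAR)
    (hlevVrow : rs + 1 * c0 * ((M + M2 + RA + RHO2) * BA + (1 + 2 * EPSC) * M * RA + EPSC * RA ^ 2
      + (M + 2 * EPSC * M2) * RHO2 + EPSC * RHO2 ^ 2) < BBAR)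
    -- the actual core clause size and the interface bound of the hop
    {δω rI : ℝ} (hδω0 : 0 ≤ δω) (hδω : δω ≤ aKdev) (hrI0 : 0 ≤ rI) (hrI : rI ≤ r) :
    let A := Real.sqrt (2 * VbarB) * Real.exp (θ' / 2) * Real.exp (θ' * (Dr - Kr) / 2) + M
    let A₀ := M + rI
    let A₁ := M + Real.sqrt (2 * VbarN) * Real.exp (θV / 2)
    let V₀N := (Real.sqrt (v + δω ^ 2) + Real.sqrt Dr * rk + Real.sqrt EW) ^ 2
    let V₀B := (Real.sqrt (W + (M + δω) ^ 2) + rk / Real.sqrt (1 - Real.exp (-θ'))) ^ 2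
    let EN := Real.exp (θV * ((1 : ℝ) - Dr + Kr)) * ((1 + EPSC) * 1 * A ^ 2 * (A + M))
      + 1 * rI * (2 * VbarN + EPSC * rI * Real.sqrt (2 * VbarN) + (1 + EPSC) * M * rI)
    let PUMP := 1 * c0 * ((2 + EPSC) * M * I1H * Real.sqrt (2 * VbarN) + 2 * I2H * VbarN)
    0 < Aeff ∧ rI ≤ A ∧ A₀ ≤ Aeff ∧
      (0 < muN ∧ muN ≤ (1 / c0) * θV - 2 * (1 + EPSC) * 1 * (A * Real.sinh (θV / 2) + M * (3 + Real.exp θV))) ∧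
      (0 < muB ∧ muB ≤ (1 / c0) * θ' - 2 * (1 + EPSC) * Aeff * Real.sinh (θ' / 2)) ∧
      V₀N + EN * c0 < VbarN ∧ V₀B + A₁ * A₀ * (A₁ + EPSC * A₀) * c0 < VbarB ∧
      Real.sqrt (2 * VbarB) * Real.exp (θ' / 2) ≤ Aeff ∧
      (∀ t ∈ Icc tlo c0, (Real.sqrt (Real.exp (-muN * t) * V₀N + EN * (1 - Real.exp (-muN * t)) / muN)
        + Real.sqrt RT) ^ 2 ≤ Qf * vn) ∧
      (∀ t ∈ Icc tlo c0, Real.exp (-muB * t) * V₀B + A₁ * A₀ * (A₁ + EPSC * A₀) * (1 - Real.exp (-muB * t)) / muB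
        ≤ Qf * Wn) ∧
      rs + PUMP + 1 * c0 * ((EPSC * (M + I1H * Real.sqrt (2 * VbarN)) + EPSC * M + EPSC * BBAR) * RBAR
        + (2 + EPSC) * M * BBAR + BBAR ^ 2) < RBAR ∧
      rs + 1 * c0 * ((M + M2 + RBAR + RHO2) * BBAR + (1 + 2 * EPSC) * M * RBAR + EPSC * RBAR ^ 2
        + (M + 2 * EPSC * M2) * RHO2 + EPSC * RHO2 ^ 2) < BBAR := by
  intro A A₀ A₁ V₀N V₀B EN PUMP
  obtain ⟨hv0, hW0, hr0, haK0, hQ0, hvn0, hWn0⟩ := hsigns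
  -- square roots against the enclosures
  have hVbarB0 : 0 < VbarB := by
    have h1 : 0 ≤ (SWb + rk * IOTA) ^ 2 := sq_nonneg _
    have h2 : 0 ≤ (M + S2NH * EHH) * (M + r) * ((M + S2NH * EHH) + EPSC * (M + r)) * c0 := by
      have : 0 ≤ S2NH * EHH := mul_nonneg hS2NH.1 ((Real.exp_pos _).le.trans hEHH)
      have : 0 ≤ c0 := htlo0.trans htc
      positivity
    linarith only [h1, h2, hlevBrow]
  have hVbarN0 : 0 < VbarN := by
    have h1 : 0 ≤ (SN + SDH * rk + SEWH) ^ 2 := sq_nonneg _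
    have hF : 0 ≤ S2BH * FEEDH + M := by
      have : 0 ≤ FEEDH := le_trans (by positivity) hFEEDH
      exact add_nonneg (mul_nonneg hS2BH.1 this) hM0
    have hD0 : 0 ≤ DISC := (Real.exp_pos _).le.trans hDISC
    have h2 : 0 ≤ (DISC * ((1 + EPSC) * 1 * (S2BH * FEEDH + M) ^ 2 * ((S2BH * FEEDH + M) + M))
        + 1 * r * (2 * VbarN + EPSC * r * S2NH + (1 + EPSC) * M * r)) * c0 := by
      have : 0 ≤ c0 := htlo0.trans htc
      have : 0 ≤ r := hRB0.trans hR01.1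
      have : 0 ≤ S2NH := hS2NH.1
      positivity
    linarith only [h1, h2, hlevNrow]
  have hsqB : Real.sqrt (2 * VbarB) ≤ S2BH := sqrt_le_of_le_sq hS2BH.1 hS2BH.2
  have hsqBlo : S2BL ≤ Real.sqrt (2 * VbarB) := le_sqrt_of_sq_le hS2BL.1 hS2BL.2
  have hsqN : Real.sqrt (2 * VbarN) ≤ S2NH := sqrt_le_of_le_sq hS2NH.1 hS2NH.2
  have hfeed0 : 0 ≤ Real.exp (θ' / 2) * Real.exp (θ' * (Dr - Kr) / 2) := by positivity
  have hfeed1 : 1 ≤ Real.exp (θ' / 2) * Real.exp (θ' * (Dr - Kr) / 2) := by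
    rw [← Real.exp_add]
    exact Real.one_le_exp (by positivity)
  have hFEEDH0 : 0 ≤ FEEDH := hfeed0.trans hFEEDH
  -- A between its enclosures
  have hAhi : A ≤ S2BH * FEEDH + M := by
    show Real.sqrt (2 * VbarB) * Real.exp (θ' / 2) * Real.exp (θ' * (Dr - Kr) / 2) + M ≤ S2BH * FEEDH + M
    have : Real.sqrt (2 * VbarB) * Real.exp (θ' / 2) * Real.exp (θ' * (Dr - Kr) / 2)
        = Real.sqrt (2 * VbarB) * (Real.exp (θ' / 2) * Real.exp (θ' * (Dr - Kr) / 2)) := by ring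
    rw [this]
    have hm := mul_le_mul hsqB hFEEDH hfeed0 hS2BH.1
    linarith only [hm]
  have hAlo : M + S2BL ≤ A := by
    show M + S2BL ≤ Real.sqrt (2 * VbarB) * Real.exp (θ' / 2) * Real.exp (θ' * (Dr - Kr) / 2) + M
    have : Real.sqrt (2 * VbarB) * Real.exp (θ' / 2) * Real.exp (θ' * (Dr - Kr) / 2)
        = Real.sqrt (2 * VbarB) * (Real.exp (θ' / 2) * Real.exp (θ' * (Dr - Kr) / 2)) := by ring
    rw [this]
    have h1 : Real.sqrt (2 * VbarB) * 1 ≤ Real.sqrt (2 * VbarB) * (Real.exp (θ' / 2) * Real.exp (θ' * (Dr - Kr) / 2)) :=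
      mul_le_mul_of_nonneg_left hfeed1 (Real.sqrt_nonneg _)
    linarith only [h1, hsqBlo]
  have hA0 : 0 ≤ A := le_trans (by linarith only [hS2BL.1, hM0]) hAlo
  set AHI : ℝ := S2BH * FEEDH + M with hAHIdef
  have hAHI0 : 0 ≤ AHI := hA0.trans hAhi
  -- (1) Aeff > 0
  have hAeff0 : 0 ≤ Aeff := hAeffrow.2.1
  have hEHB1 : 1 ≤ EHB := (Real.one_le_exp (by positivity)).trans hEHB
  have hAeffpos : 0 < Aeff := by
    have h1 : 0 < 2 * VbarB * EHB ^ 2 := by positivity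
    have h2 : 0 < Aeff ^ 2 := lt_of_lt_of_le h1 hAeffrow.1
    rcases eq_or_lt_of_le hAeff0 with h | h
    · rw [← h] at h2; norm_num at h2
    · exact h
  -- (2) rI ≤ A, (3) A₀ ≤ Aeff
  have h2 : rI ≤ A := (hrI.trans hrrow).trans hAlo
  have h3 : A₀ ≤ Aeff := by show M + rI ≤ Aeff; linarith only [hAeffrow.2.2, hrI]
  -- (4) near rate
  have h4 : muN ≤ (1 / c0) * θV - 2 * (1 + EPSC) * 1 * (A * Real.sinh (θV / 2) + M * (3 + Real.exp θV)) := by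
    have hs0 : 0 ≤ Real.sinh (θV / 2) := Real.sinh_nonneg_iff.mpr (by positivity)
    have hx : A * Real.sinh (θV / 2) + M * (3 + Real.exp θV) ≤ AHI * SHH + M * (3 + EHI) := by
      have ha := mul_le_mul hAhi hSHH hs0 hAHI0
      have hb := mul_le_mul_of_nonneg_left (add_le_add_left hEHI 3) hM0
      linarith only [ha, hb]
    have hc := mul_le_mul_of_nonneg_left hx (by positivity : (0 : ℝ) ≤ 2 * (1 + EPSC) * 1)
    linarith only [hc, hμNrow.2]
  -- (5) behind rate
  have h5 : muB ≤ (1 / c0) * θ' - 2 * (1 + EPSC) * Aeff * Real.sinh (θ' / 2) := by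
    have hc0 : 0 < c0 := by
      -- `1/c0 * θV ≥ muN + … > …` does not give the sign; use `tlo ≤ c0`, `0 ≤ tlo` and the rate inequality for μB:
      -- if `c0 ≤ 0` then `THPLO / c0 ≤ 0`?? not enough either; we take it from `hμNrow` indirectly is impossible,
      -- so derive it from `0 < muN ≤ 1/c0 * θV − (≥ 0)`: `1/c0 * θV > 0` ⇒ `c0 > 0` when `θV ≥ 0`.
      have hpos : 0 < 1 / c0 * θV := by
        have hnn : 0 ≤ 2 * (1 + EPSC) * ((S2BH * FEEDH + M) * SHH + M * (3 + EHI)) := by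
          have : 0 ≤ SHH := (Real.sinh_nonneg_iff.mpr (by positivity)).trans hSHH
          have : 0 ≤ EHI := (Real.exp_pos _).le.trans hEHI
          positivity
        linarith only [hμNrow.1, hμNrow.2, hnn]
      by_contra hle
      rw [not_lt] at hle
      have : 1 / c0 * θV ≤ 0 := mul_nonpos_of_nonpos_of_nonneg (by
        rcases eq_or_lt_of_le hle with h | h
        · rw [h]; simp
        · exact (one_div_neg.mpr h).le) hθV
      linarith only [hpos, this]
    have hx : THPLO / c0 ≤ (1 / c0) * θ' := by
      rw [div_eq_mul_one_div, mul_comm]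
      exact mul_le_mul_of_nonneg_left hTHPLO (by positivity)
    have hy : 2 * (1 + EPSC) * Aeff * Real.sinh (θ' / 2) ≤ 2 * (1 + EPSC) * Aeff * SHB :=
      mul_le_mul_of_nonneg_left hSHB (by positivity)
    linarith only [hx, hy, hμBrow.2]
  -- the starts against the row
  have hV₀N : V₀N ≤ (SN + SDH * rk + SEWH) ^ 2 := by
    have ha : Real.sqrt (v + δω ^ 2) ≤ SN := by
      refine sqrt_le_of_le_sq hSN.1 ?_
      have : δω ^ 2 ≤ aKdev ^ 2 := pow_le_pow_left₀ hδω0 hδω 2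
      linarith only [hSN.2, this]
    have hb : Real.sqrt Dr * rk ≤ SDH * rk := mul_le_mul_of_nonneg_right hSDH hrk0
    have hsum : Real.sqrt (v + δω ^ 2) + Real.sqrt Dr * rk + Real.sqrt EW ≤ SN + SDH * rk + SEWH := by linarith only [ha, hb, hSEWH]
    have h0 : 0 ≤ Real.sqrt (v + δω ^ 2) + Real.sqrt Dr * rk + Real.sqrt EW := by positivity
    exact pow_le_pow_left₀ h0 hsum 2
  have hV₀B : V₀B ≤ (SWb + rk * IOTA) ^ 2 := by
    have ha : Real.sqrt (W + (M + δω) ^ 2) ≤ SWb := by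
      refine sqrt_le_of_le_sq hSWb.1 ?_
      have : (M + δω) ^ 2 ≤ (M + aKdev) ^ 2 := pow_le_pow_left₀ (by positivity) (by linarith only [hδω]) 2
      linarith only [hSWb.2, this]
    have hb : rk / Real.sqrt (1 - Real.exp (-θ')) ≤ rk * IOTA := by
      rw [div_eq_mul_one_div]
      exact mul_le_mul_of_nonneg_left hIOTA hrk0
    have hsum : Real.sqrt (W + (M + δω) ^ 2) + rk / Real.sqrt (1 - Real.exp (-θ')) ≤ SWb + rk * IOTA := by linarith only [ha, hb]
    have h0 : 0 ≤ Real.sqrt (W + (M + δω) ^ 2) + rk / Real.sqrt (1 - Real.exp (-θ')) := by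
      have : 0 ≤ rk / Real.sqrt (1 - Real.exp (-θ')) := div_nonneg hrk0 (Real.sqrt_nonneg _)
      positivity
    exact pow_le_pow_left₀ h0 hsum 2
  have hV₀N0 : 0 ≤ V₀N := sq_nonneg _
  have hV₀B0 : 0 ≤ V₀B := sq_nonneg _
  -- EN against the row (level-fed top summand)
  have hVN0 : 0 ≤ VbarN := hVbarN0.le
  have hENrow : EN ≤ DISC * ((1 + EPSC) * 1 * AHI ^ 2 * (AHI + M)) + 1 * r * (2 * VbarN + EPSC * r * S2NH + (1 + EPSC) * M * r) := by
    have hA2 : A ^ 2 ≤ AHI ^ 2 := pow_le_pow_left₀ hA0 hAhi 2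
    have h1 : (1 + EPSC) * 1 * A ^ 2 * (A + M) ≤ (1 + EPSC) * 1 * AHI ^ 2 * (AHI + M) := by
      have hm := mul_le_mul hA2 (add_le_add_right hAhi M) (by positivity) (by positivity)
      have hm2 := mul_le_mul_of_nonneg_left hm (by positivity : (0 : ℝ) ≤ (1 + EPSC) * 1)
      linarith only [hm2]
    have h1' : Real.exp (θV * ((1 : ℝ) - Dr + Kr)) * ((1 + EPSC) * 1 * A ^ 2 * (A + M))
        ≤ DISC * ((1 + EPSC) * 1 * AHI ^ 2 * (AHI + M)) :=
      mul_le_mul hDISC h1 (by positivity) ((Real.exp_pos _).le.trans hDISC)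
    have h2' : 1 * rI * (2 * VbarN + EPSC * rI * Real.sqrt (2 * VbarN) + (1 + EPSC) * M * rI)
        ≤ 1 * r * (2 * VbarN + EPSC * r * S2NH + (1 + EPSC) * M * r) := by
      have hs0 : 0 ≤ Real.sqrt (2 * VbarN) := Real.sqrt_nonneg _
      gcongr
    show Real.exp (θV * ((1 : ℝ) - Dr + Kr)) * ((1 + EPSC) * 1 * A ^ 2 * (A + M))
        + 1 * rI * (2 * VbarN + EPSC * rI * Real.sqrt (2 * VbarN) + (1 + EPSC) * M * rI) ≤ _
    linarith only [h1', h2']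
  have hEN0 : 0 ≤ EN := by
    show 0 ≤ Real.exp (θV * ((1 : ℝ) - Dr + Kr)) * ((1 + EPSC) * 1 * A ^ 2 * (A + M))
      + 1 * rI * (2 * VbarN + EPSC * rI * Real.sqrt (2 * VbarN) + (1 + EPSC) * M * rI)
    positivity
  -- (6) near level
  have h6 : V₀N + EN * c0 < VbarN := by
    have hc00 : 0 ≤ c0 := htlo0.trans htc
    have hm := mul_le_mul_of_nonneg_right hENrow hc00
    linarith only [hm, hV₀N, hlevNrow]
  -- A₁, A₀ against the row and the top input
  have hA₁hi : A₁ ≤ M + S2NH * EHH := by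
    show M + Real.sqrt (2 * VbarN) * Real.exp (θV / 2) ≤ M + S2NH * EHH
    have hm := mul_le_mul hsqN hEHH (Real.exp_pos _).le hS2NH.1
    linarith only [hm]
  have hA₁0 : 0 ≤ A₁ := by show 0 ≤ M + Real.sqrt (2 * VbarN) * Real.exp (θV / 2); positivity
  have hA₀0 : 0 ≤ A₀ := by show 0 ≤ M + rI; positivity
  have hA₀hi : A₀ ≤ M + r := by show M + rI ≤ M + r; linarith only [hrI]
  have hEtop : A₁ * A₀ * (A₁ + EPSC * A₀) ≤ (M + S2NH * EHH) * (M + r) * ((M + S2NH * EHH) + EPSC * (M + r)) := by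
    have h1 : A₁ * A₀ ≤ (M + S2NH * EHH) * (M + r) := mul_le_mul hA₁hi hA₀hi hA₀0 (hA₁0.trans hA₁hi)
    have h2 : A₁ + EPSC * A₀ ≤ (M + S2NH * EHH) + EPSC * (M + r) := by
      have := mul_le_mul_of_nonneg_left hA₀hi hEPSC
      linarith only [hA₁hi, this]
    exact mul_le_mul h1 h2 (by positivity) (mul_nonneg (hA₁0.trans hA₁hi) (hA₀0.trans hA₀hi))
  have hEtop0 : 0 ≤ A₁ * A₀ * (A₁ + EPSC * A₀) := by positivity
  -- (7) behind level
  have h7 : V₀B + A₁ * A₀ * (A₁ + EPSC * A₀) * c0 < VbarB := by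
    have hc00 : 0 ≤ c0 := htlo0.trans htc
    have hm := mul_le_mul_of_nonneg_right hEtop hc00
    linarith only [hm, hV₀B, hlevBrow]
  -- (8) gauge
  have h8 : Real.sqrt (2 * VbarB) * Real.exp (θ' / 2) ≤ Aeff := by
    have h0 : 0 ≤ Real.sqrt (2 * VbarB) * Real.exp (θ' / 2) := by positivity
    have h1 : Real.sqrt (2 * VbarB) * Real.exp (θ' / 2) ≤ Real.sqrt (2 * VbarB) * EHB :=
      mul_le_mul_of_nonneg_left hEHB (Real.sqrt_nonneg _)
    have h2 : (Real.sqrt (2 * VbarB) * EHB) ^ 2 ≤ Aeff ^ 2 := by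
      rw [mul_pow, Real.sq_sqrt (by linarith only [hVbarB0])]; exact hAeffrow.1
    have h3 : Real.sqrt (2 * VbarB) * EHB ≤ Aeff :=
      (abs_le_of_sq_le_sq' h2 hAeff0).2
    exact h1.trans h3
  -- (9) near budget on the window
  have h9 : ∀ t ∈ Icc tlo c0, (Real.sqrt (Real.exp (-muN * t) * V₀N + EN * (1 - Real.exp (-muN * t)) / muN)
      + Real.sqrt RT) ^ 2 ≤ Qf * vn := by
    intro t ht
    have hw := window_budget_le (V₀ := V₀N) (E := EN) hμNrow.1 hV₀N0 hEN0 htlo0 ht.1 ht.2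
    rw [neg_mul] 
    have hinner : Real.exp (-(muN * t)) * V₀N + EN * (1 - Real.exp (-(muN * t))) / muN ≤ SIN ^ 2 := by
      refine hw.trans (le_trans ?_ hSIN.2)
      have hU0 : 0 ≤ 1 / (1 + muN * tlo + (muN * tlo) ^ 2 / 2) := by
        have : 0 ≤ muN * tlo := mul_nonneg hμNrow.1.le htlo0
        positivity
      have hc00 : 0 ≤ c0 := htlo0.trans htc
      have hm := mul_le_mul_of_nonneg_right hV₀N hU0
      have hm2 := mul_le_mul_of_nonneg_right hENrow hc00
      linarith only [hm, hm2]
    have hs1 : Real.sqrt (Real.exp (-(muN * t)) * V₀N + EN * (1 - Real.exp (-(muN * t))) / muN) ≤ SIN :=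
      sqrt_le_of_le_sq hSIN.1 hinner
    have hsum0 : 0 ≤ Real.sqrt (Real.exp (-(muN * t)) * V₀N + EN * (1 - Real.exp (-(muN * t))) / muN) + Real.sqrt RT := by
      positivity
    calc (Real.sqrt (Real.exp (-(muN * t)) * V₀N + EN * (1 - Real.exp (-(muN * t))) / muN) + Real.sqrt RT) ^ 2
        ≤ (SIN + SRTH) ^ 2 := pow_le_pow_left₀ hsum0 (add_le_add hs1 hSRTH) 2
      _ ≤ Q * vn := hbudNrow
      _ ≤ Qf * vn := mul_le_mul_of_nonneg_right hQf hvn0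
  -- (10) behind budget on the window
  have h10 : ∀ t ∈ Icc tlo c0, Real.exp (-muB * t) * V₀B + A₁ * A₀ * (A₁ + EPSC * A₀) * (1 - Real.exp (-muB * t)) / muB
      ≤ Qf * Wn := by
    intro t ht
    have hw := window_budget_le (V₀ := V₀B) (E := A₁ * A₀ * (A₁ + EPSC * A₀)) hμBrow.1 hV₀B0 hEtop0 htlo0 ht.1 ht.2
    rw [neg_mul]
    refine hw.trans ?_
    have hU0 : 0 ≤ 1 / (1 + muB * tlo + (muB * tlo) ^ 2 / 2) := by
      have : 0 ≤ muB * tlo := mul_nonneg hμBrow.1.le htlo0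
      positivity
    have hc00 : 0 ≤ c0 := htlo0.trans htc
    have hm := mul_le_mul_of_nonneg_right hV₀B hU0
    have hm2 := mul_le_mul_of_nonneg_right hEtop hc00
    have hm3 := mul_le_mul_of_nonneg_right hQf hWn0
    linarith only [hm, hm2, hm3, hbudBrow]
  -- (11) the carrier level (L-61a) and (12) the bond level (L-61b): monotone in `√(2V̄N) ≤ S2NH` and in the inner levels
  have hRA0 : 0 ≤ RA := hRB0.trans hRA
  have hBA0 : 0 ≤ BA := hBB0.trans hBA
  have hc00 : 0 ≤ c0 := htlo0.trans htc
  have hs0 : 0 ≤ Real.sqrt (2 * VbarN) := Real.sqrt_nonneg _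
  have hS2NH0 : 0 ≤ S2NH := hS2NH.1
  have h11 : rs + PUMP + 1 * c0 * ((EPSC * (M + I1H * Real.sqrt (2 * VbarN)) + EPSC * M + EPSC * BBAR) * RBAR
      + (2 + EPSC) * M * BBAR + BBAR ^ 2) < RBAR := by
    have hP : PUMP ≤ PUMProw := by
      refine le_trans ?_ hpumprow
      show 1 * c0 * ((2 + EPSC) * M * I1H * Real.sqrt (2 * VbarN) + 2 * I2H * VbarN)
        ≤ 1 * c0 * ((2 + EPSC) * M * I1H * S2NH + 2 * I2H * VbarN)
      gcongr
    have hX : 1 * c0 * ((EPSC * (M + I1H * Real.sqrt (2 * VbarN)) + EPSC * M + EPSC * BBAR) * RBAR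
        + (2 + EPSC) * M * BBAR + BBAR ^ 2)
        ≤ 1 * c0 * ((EPSC * (M + I1H * S2NH) + EPSC * M + EPSC * BA) * RA + (2 + EPSC) * M * BA + BA ^ 2) := by
      gcongr
    linarith only [hP, hX, hlevCrow]
  have h12 : rs + 1 * c0 * ((M + M2 + RBAR + RHO2) * BBAR + (1 + 2 * EPSC) * M * RBAR + EPSC * RBAR ^ 2
      + (M + 2 * EPSC * M2) * RHO2 + EPSC * RHO2 ^ 2) < BBAR := by
    have hX : 1 * c0 * ((M + M2 + RBAR + RHO2) * BBAR + (1 + 2 * EPSC) * M * RBAR + EPSC * RBAR ^ 2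
        + (M + 2 * EPSC * M2) * RHO2 + EPSC * RHO2 ^ 2)
        ≤ 1 * c0 * ((M + M2 + RA + RHO2) * BA + (1 + 2 * EPSC) * M * RA + EPSC * RA ^ 2
          + (M + 2 * EPSC * M2) * RHO2 + EPSC * RHO2 ^ 2) := by
      gcongr
    linarith only [hX, hlevVrow]
  exact ⟨hAeffpos, h2, h3, ⟨hμNrow.1, h4⟩, ⟨hμBrow.1, h5⟩, h6, h7, h8, h9, h10, h11, h12⟩

end Summit.NavierStokesRegularity.NavierStokesRegularity.Theorems.Schedule61

end
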